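import Literature.MathematicalPhysics.QuantumFieldTheory.Balaban1983to89.B12FormatPlus
import Literature.MathematicalPhysics.QuantumFieldTheory.Balaban1983to89.Step

/-!
# NODE O port, row PT-A′ helper lane (PTZ-1): the ZERO-INPUT SPLIT recombined in the `FormatPlusG` vehicle — (Z) ∧ (L) ⟹ the wall's
# uniform format, at the MOULD level (every slot a variable), under the BOX binder and under the SAME-RUN FLOW GUARD of record

[Balaban1987RG1] = [I] (CMP 109, 1987): (1.18)–(1.19) p. 263, Thm 3 p. 264, (0.20) p. 256; [Balaban1988RG2Cluster] = [II] (CMP 116, 1988):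
p. 21 L10–20 («O(1)C₃ε₁ ≤ ½E₀ … we can take E₀ such that the assumption is satisfied»).

Seat `ymgap-nodeO-port-PTZ-1` g0 (prover, HELPER MODE; every file `--supports stmt-QuantumFields-27930 --as helper`; nothing keyed to the unsigned
item 26648).  This module is the IMPORTABLE home of the split glue the NODE-O lens seat `ymgap-nodeO-lens-2` wrote in the crux workfiles
`Summits/…/Cruxes/Record13SepCoPHInhabited/Lens2G4ZeroInputSplitSketch.lean` (Sketch v7 §2) ∕ `…/Lens2G6HistMulWindowSketch.lean` (Sketch v9.2 §2:
`gaugeInv119_add` :350, `formatPlusG_add` :357, `formatPlusG_congr` :380, `formatPlusG_of_split` :391, `uniformFormat_of_split` :558) and in the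
probe `nodeO-cover/LENS-2-ZD-TextProbe-v2.lean` (`bodyJ_uniform_of_split_flow` :319) — crux workfiles and probes are NOT importable by a Theorems
file, and the closer of `PortZeroInputSplitZD` (26648, when signed over the Ax names) and the derivation 26648 ⟹ 27930 need these lemmas BY NAME.
§1 is lens-2's text VERBATIM up to the namespace (attribution above; typer-lint: cited, not re-invented); §2 is the LEVEL-INDEXED glue written
WITHOUT auxiliary definitions (a proof file declares none): the wall's body, (Z) and (L) are spelled out as `FormatPlusG` families indexed by the
level `k`, once under the BOX binder `∀ k, ∀ v ∈ FlowStep.Box γ₀ k` (27930⁷'s shape) and once under the SAME-RUN FLOW GUARD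
`∀ k g, FlowStep.RGEqH k β g → Step.InInterval γ₀ k g → …` with histories `FlowStep.prefixOf g k` (CRIT-1 g33 RULING R-H (R-G1′) + T-1 FORM
«SAME-RUN», HOME STATUS l.3784 ∕ l.3803: the shape of 27930⁸ ∕ 26648 v4Ax), `β` BOUND — so both are selection-FREE (CRIT-1 Q-5 (β)).

WHAT IS PROVED (0 sorry; no `def`, no `instance`, no `notation`):
* §1 one level: `gaugeInv119_add` ((1.19) rows add), `formatPlusG_add` (formats add in `FormatPlusG`, constants add), `formatPlusG_congr` (the mould
  reads only the germ of the functional at `0`), `formatPlusG_of_split` ((Z) at `σ` + the difference functional at `τ` ⟹ the functional at `σ + τ`),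
  `formatPlusG_mono` (the format is monotone in its constant, `Bound118.mono`), `formatPlusG_of_eventually_zero` (a functional vanishing near `0`
  has every format `E₀ ≥ 0` with the zero pieces — the `k = 0` instance of (L): no history at the first step, (0.17)).
* §2 all levels: `formatPlusG_uniform_of_split_box` — (Z) at `σ > 0` for every level ∧ (L) «for `0 < E ≤ Ē`, format `E` at all previous levels ⟹
  format `ρ·E` of the difference at this level» with `ρ < 1` and the closure `σ ≤ (1 − ρ)·Ē` ⟹ format `E₀ := σ∕(1 − ρ)` at EVERY level (strong
  induction on `k` = [II] p. 21's choice of `E₀`; full-memory Grönwall); `formatPlusG_uniform_of_split_flow` — the same under the same-run flow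
  guard, the guard being prefix-closed (`RGEqH k β g → RGEqH k₁ β g`, `InInterval γ₀ k g → InInterval γ₀ k₁ g` for `k₁ ≤ k`, inlined);
  `formatPlusG_uniform_of_split_flow_allRuns` — the variant whose (L)-antecedent quantifies over ALL guarded runs at the previous levels (typer v3
  194d36781ea0712a shape; weaker (L), same conclusion); `E₀_pos_of_split` ∕ `E₀_le_of_split` ∕ `split_const_eq` — the guard facts `0 < σ∕(1−ρ) ≤ Ē`
  and the fixed point `σ + ρ·σ∕(1−ρ) = σ∕(1−ρ)` a closer needs for the wall's constant block; `formatPlusG_flow_of_box` — the box-indexed conclusion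
  implies the flow-indexed one (a guarded run's prefix lies in the box; lens-2 probe `text30Jv8_of_text30J` at the mould level).

HONEST FRAMING.  Mould-level bookkeeping (formats add; induction on the level); NOTHING of Bałaban's estimates — in particular neither (Z) (Thm 3's
step at zero input) nor (L) ([II] Lemma 3 in parametric dress) — is asserted, ported or discharged; 26648 UNSIGNED, 27930⁷ ∕ 27931⁷ OPEN,
K0⁷ ∕ stub 2′ OPEN; counts unmoved; finite 𝕋⁴ at fixed ε — NOT continuum ∕ OS ∕ Clay; the Yang–Mills mass gap is NOT proved by any of this.
-/

noncomputable section

namespace Summit.QuantumFields.YangMills.Theorems.PortZDSplit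

open Literature.MathematicalPhysics.QuantumFieldTheory.Balaban1983to89
open Literature.MathematicalPhysics.QuantumFieldTheory.Balaban1983to89.B12FormatPlus
open _root_.Filter _root_.Topology

/-! ## §1. One level: formats add in the `FormatPlusG` vehicle; the split recombines (lens-2 Sketch v9.2 §2, re-homed verbatim) -/

section Mould

variable {S : ℕ → LocDomainSys} {M m : ℕ → ℕ}
  {Uc : (n : ℕ) → (S n).Dom → Set (Fin (M n) → ℂ)} {coords : (n : ℕ) → (S n).Dom → Finset (Fin (M n))}
  {χ : (n : ℕ) → (S n).Dom → (Fin (m n) → ℂ) → (Fin (M n) → ℂ)} {W : ℕ → Type*} [∀ n, TopologicalSpace (W n)]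
  [∀ n, Zero (W n)] {Φ₁ Φ₂ Φf Ψ : (n : ℕ) → W n → ℂ} {ι : (n : ℕ) → W n → (Fin (m n) → ℂ)}
  {wrap : (n : ℕ) → Finset (S n).Dom} {emb : (n : ℕ) → (S n).Dom → (S (n + 1)).Dom}
  {πc : (n : ℕ) → (S n).Dom → (Fin (M (n + 1)) → ℂ) → (Fin (M n) → ℂ)} {E₁ E₂ E₀ κ : ℝ}

/-- **The (1.19) rows add**: two gauge-invariant piece families on the same spaces have a gauge-invariant sum (lens-2 Sketch v9.2 §2 :350).
[cite: Balaban1987RG1, (1.19) p.263] -/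
theorem gaugeInv119_add {G : ℕ → Type*} {act : (n : ℕ) → G n → (Fin (M n) → ℂ) → (Fin (M n) → ℂ)} {P Q : Pieces S M}
    (hP : GaugeInv119 act Uc P) (hQ : GaugeInv119 act Uc Q) :
    GaugeInv119 act Uc (fun n X u => P n X u + Q n X u) :=
  ⟨hP.1, fun n g X u => congrArg₂ (· + ·) (hP.2 n g X u) (hQ.2 n g X u)⟩

/-- **Formats add in the `FormatPlusG` vehicle** (the five rows ∧ (1.19) for the SAME pieces; constants add, decay rate shared): termwise sum of the
pieces, `‖P + Q‖ ≤ (E₁ + E₂)e^{−κd}`, locality ∕ representation ∕ volume-independence ∕ (1.19) by additivity (lens-2 Sketch v9.2 §2 :357).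
[cite: Balaban1987RG1, (1.18)–(1.19) p.263, (1.6)–(1.7) p.261] -/
theorem formatPlusG_add {G : ℕ → Type*} {act : (n : ℕ) → G n → (Fin (M n) → ℂ) → (Fin (M n) → ℂ)}
    (h₁ : FormatPlusG S M act Uc coords m χ Φ₁ ι wrap emb πc E₁ κ)
    (h₂ : FormatPlusG S M act Uc coords m χ Φ₂ ι wrap emb πc E₂ κ) :
    FormatPlusG S M act Uc coords m χ (fun n B => Φ₁ n B + Φ₂ n B) ι wrap emb πc (E₁ + E₂) κ := by
  obtain ⟨P, hA, hB, hL, hR, hV, hG⟩ := h₁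
  obtain ⟨Q, hA', hB', hL', hR', hV', hG'⟩ := h₂
  refine ⟨fun n X u => P n X u + Q n X u, ?_, ?_, ?_, ?_, ?_, gaugeInv119_add hG hG'⟩
  · intro n X
    exact (hA n X).add (hA' n X)
  · intro n X u hu
    calc ‖P n X u + Q n X u‖ ≤ ‖P n X u‖ + ‖Q n X u‖ := norm_add_le _ _
      _ ≤ E₁ * Real.exp (-κ * (S n).dj X) + E₂ * Real.exp (-κ * (S n).dj X) :=
          add_le_add (hB n X u hu) (hB' n X u hu)
      _ = (E₁ + E₂) * Real.exp (-κ * (S n).dj X) := by ring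
  · intro n X u u' h
    exact congrArg₂ (· + ·) (hL n X u u' h) (hL' n X u u' h)
  · intro n
    filter_upwards [hR n, hR' n] with B h1 h2
    rw [h1, h2, ← Finset.sum_add_distrib]
  · intro n X hX u'
    exact congrArg₂ (· + ·) (hV n X hX u') (hV' n X hX u')

/-- **The mould reads only the germ of the functional at `0`** (the (S1) row `Repr17` is an `∀ᶠ B in 𝓝 0` statement; lens-2 Sketch v9.2 §2 :380).
[cite: Balaban1987RG1, (1.6)–(1.7) p.261 (bookkeeping)] -/
theorem formatPlusG_congr {G : ℕ → Type*} {act : (n : ℕ) → G n → (Fin (M n) → ℂ) → (Fin (M n) → ℂ)}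
    (h : FormatPlusG S M act Uc coords m χ Φf ι wrap emb πc E₀ κ) (heq : ∀ n, ∀ᶠ B in 𝓝 (0 : W n), Ψ n B = Φf n B) :
    FormatPlusG S M act Uc coords m χ Ψ ι wrap emb πc E₀ κ := by
  obtain ⟨P, hA, hB, hL, hR, hV, hG⟩ := h
  refine ⟨P, hA, hB, hL, ?_, hV, hG⟩
  intro n
  filter_upwards [hR n, heq n] with B h1 h2
  rw [h2, h1]

/-- **THE SPLIT RECOMBINED**: the zero-input functional `Φz` in format `σ` and the difference functional `Φ − Φz` in format `τ` — both with the
(1.19) row — give `Φ` in format `σ + τ` (lens-2 Sketch v9.2 §2 :391). [cite: Balaban1987RG1, (1.18)–(1.19) p.263] -/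
theorem formatPlusG_of_split {G : ℕ → Type*} {act : (n : ℕ) → G n → (Fin (M n) → ℂ) → (Fin (M n) → ℂ)}
    {Φ Φz : (n : ℕ) → W n → ℂ} {σ τ : ℝ}
    (hZ : FormatPlusG S M act Uc coords m χ Φz ι wrap emb πc σ κ)
    (hD : FormatPlusG S M act Uc coords m χ (fun n B => Φ n B - Φz n B) ι wrap emb πc τ κ) :
    FormatPlusG S M act Uc coords m χ Φ ι wrap emb πc (σ + τ) κ :=
  formatPlusG_congr (formatPlusG_add hZ hD) fun n => Filter.Eventually.of_forall fun B => by
    show Φ n B = Φz n B + (Φ n B - Φz n B)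
    ring

/-- **The format is monotone in its constant** (`Bound118.mono`; the other rows do not read `E₀`) — «formats are monotone in E» (lens-2 TYPING
BRIEF v2 note (a)). [cite: Balaban1987RG1, (1.18) p.263 (bookkeeping)] -/
theorem formatPlusG_mono {G : ℕ → Type*} {act : (n : ℕ) → G n → (Fin (M n) → ℂ) → (Fin (M n) → ℂ)} {E₀' : ℝ}
    (h : FormatPlusG S M act Uc coords m χ Φf ι wrap emb πc E₀ κ) (hE₀ : 0 ≤ E₀) (hle : E₀ ≤ E₀') :
    FormatPlusG S M act Uc coords m χ Φf ι wrap emb πc E₀' κ := by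
  obtain ⟨P, hA, hB, hL, hR, hV, hG⟩ := h
  exact ⟨P, hA, hB.mono hle le_rfl hE₀, hL, hR, hV, hG⟩

/-- **A FUNCTIONAL VANISHING NEAR `0` HAS EVERY FORMAT `E₀ ≥ 0`, WITH THE ZERO PIECES** (given only that the (1.10) action preserves the spaces —
the first clause of `GaugeInv119`, a property of `act` and `Uc` alone): the `k = 0` instance of (L) for free, since at the first step there is NO
input history ((0.17); the tree's `ZeroInput.dChannel_zero_at_first_level'`: 𝓝_1 = 𝓝⁰_1). [cite: Balaban1987RG1, (0.17) p.255, (1.18)–(1.19) p.263 (bookkeeping)] -/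
theorem formatPlusG_of_eventually_zero {G : ℕ → Type*} {act : (n : ℕ) → G n → (Fin (M n) → ℂ) → (Fin (M n) → ℂ)}
    (hact : ∀ n (g : G n) X, Set.MapsTo (act n g) (Uc n X) (Uc n X)) (hΨ : ∀ n, ∀ᶠ B in 𝓝 (0 : W n), Ψ n B = 0) (hE₀ : 0 ≤ E₀) :
    FormatPlusG S M act Uc coords m χ Ψ ι wrap emb πc E₀ κ := by
  refine ⟨fun _ _ _ => 0, fun n X => analyticOnNhd_const, fun n X u _ => ?_, fun _ _ _ _ _ => rfl, fun n => ?_, fun _ _ _ _ => rfl,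
    hact, fun _ _ _ _ => rfl⟩
  · rw [norm_zero]
    exact mul_nonneg hE₀ (Real.exp_pos _).le
  · filter_upwards [hΨ n] with B hB
    rw [hB, Finset.sum_const_zero]

end Mould

/-! ## §2. All levels: (Z) ∧ (L) ⟹ the wall's uniform format with `E₀ := σ∕(1 − ρ)` — box binder, same-run flow guard, all-runs variant -/

section Levels

variable (S : ℕ → ℕ → LocDomainSys) (M m : ℕ → ℕ → ℕ) {G : ℕ → ℕ → Type*}
  (act : (k n : ℕ) → G k n → (Fin (M k n) → ℂ) → (Fin (M k n) → ℂ))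
  (Uc : (k n : ℕ) → (S k n).Dom → Set (Fin (M k n) → ℂ)) (coords : (k n : ℕ) → (S k n).Dom → Finset (Fin (M k n)))
  (χ : (k n : ℕ) → (S k n).Dom → (Fin (m k n) → ℂ) → (Fin (M k n) → ℂ)) (W : ℕ → ℕ → Type*)
  [∀ k n, TopologicalSpace (W k n)] [∀ k n, Zero (W k n)]
  (Φ Φz : (k : ℕ) → (Fin (k + 1) → ℝ) → (n : ℕ) → W k n → ℂ) (ι : (k n : ℕ) → W k n → (Fin (m k n) → ℂ))
  (wrap : (k n : ℕ) → Finset (S k n).Dom) (emb : (k n : ℕ) → (S k n).Dom → (S k (n + 1)).Dom)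
  (πc : (k n : ℕ) → (S k n).Dom → (Fin (M k (n + 1)) → ℂ) → (Fin (M k n) → ℂ))

/-- The wall's constant produced by the split is positive: `0 < σ∕(1 − ρ)` for `0 < σ`, `ρ < 1`. [cite: Balaban1988RG2Cluster, p.21 (bookkeeping)] -/
theorem E₀_pos_of_split {σ ρ : ℝ} (hσ : 0 < σ) (hρ1 : ρ < 1) : 0 < σ / (1 - ρ) :=
  div_pos hσ (by linarith)

/-- … and inside (L)'s range: `σ∕(1 − ρ) ≤ Ē` is the closure `σ ≤ (1 − ρ)·Ē` ([II] p. 21 L16–20 «we can take E₀ such that the assumption is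
satisfied»). [cite: Balaban1988RG2Cluster, p.21] -/
theorem E₀_le_of_split {σ ρ Ē : ℝ} (hρ1 : ρ < 1) (hcl : σ ≤ (1 - ρ) * Ē) : σ / (1 - ρ) ≤ Ē := by
  rw [div_le_iff₀ (by linarith)]
  linarith

/-- The fixed-point identity of the glue: `σ + ρ·(σ∕(1 − ρ)) = σ∕(1 − ρ)`. [cite: Balaban1988RG2Cluster, p.21 (bookkeeping)] -/
theorem split_const_eq {σ ρ : ℝ} (hρ1 : ρ < 1) : σ + ρ * (σ / (1 - ρ)) = σ / (1 - ρ) := by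
  have hne : 1 - ρ ≠ 0 := by
    intro h
    linarith
  field_simp
  ring

/-- **(Z) ∧ (L) ⟹ THE WALL, BOX BINDER** (27930⁷'s `∀ k, ∀ v ∈ FlowStep.Box γ₀ k`).  (Z): the zero-input functional `Φz k v` has format `σ > 0` at
every level and admissible history; (L): for every `0 < E ≤ Ē`, format `E` of `Φ j w` at ALL previous levels `j < k` (and admissible `w`) gives
format `ρ·E` of the difference `Φ k v − Φz k v`, with `ρ < 1` and the closure `σ ≤ (1 − ρ)·Ē`.  THEN `Φ k v` has the ONE format `E₀ := σ∕(1 − ρ)`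
at every level — strong induction on `k`: the induction hypothesis feeds (L) at `E := E₀` (inside the range by `E₀_le_of_split`), `formatPlusG_of_split`
gives `σ + ρE₀ = E₀` (lens-2 Sketch v9.2 §2 :558 in the `FormatPlusG` vehicle).
[cite: Balaban1987RG1, (1.18)–(1.19) p.263; Balaban1988RG2Cluster, p.21] -/
theorem formatPlusG_uniform_of_split_box {γ₀ σ ρ Ē κ : ℝ} (hσ : 0 < σ) (hρ1 : ρ < 1) (hcl : σ ≤ (1 - ρ) * Ē)
    (hZ : ∀ k v, v ∈ FlowStep.Box γ₀ k →
      FormatPlusG (S k) (M k) (act k) (Uc k) (coords k) (m k) (χ k) (Φz k v) (ι k) (wrap k) (emb k) (πc k) σ κ)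
    (hL : ∀ k v, v ∈ FlowStep.Box γ₀ k → ∀ E : ℝ, 0 < E → E ≤ Ē →
      (∀ j, j < k → ∀ w, w ∈ FlowStep.Box γ₀ j →
        FormatPlusG (S j) (M j) (act j) (Uc j) (coords j) (m j) (χ j) (Φ j w) (ι j) (wrap j) (emb j) (πc j) E κ) →
      FormatPlusG (S k) (M k) (act k) (Uc k) (coords k) (m k) (χ k) (fun n B => Φ k v n B - Φz k v n B) (ι k) (wrap k)
        (emb k) (πc k) (ρ * E) κ) :
    ∀ k v, v ∈ FlowStep.Box γ₀ k →
      FormatPlusG (S k) (M k) (act k) (Uc k) (coords k) (m k) (χ k) (Φ k v) (ι k) (wrap k) (emb k) (πc k) (σ / (1 - ρ)) κ := by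
  have hE0 := E₀_pos_of_split hσ hρ1
  have hEbar := E₀_le_of_split hρ1 hcl
  intro k
  induction k using Nat.strong_induction_on with
  | h k ih =>
    intro v hv
    have h := formatPlusG_of_split (hZ k v hv) (hL k v hv (σ / (1 - ρ)) hE0 hEbar fun j hj w hw => ih j hj w hw)
    rwa [split_const_eq hρ1] at h

/-- **(Z) ∧ (L) ⟹ THE WALL, SAME-RUN FLOW GUARD** (the shape of record after CRIT-1's RULING R-H (R-G1′) and T-1 FORM «SAME-RUN»: binder
`∀ k g, FlowStep.RGEqH k β g → Step.InInterval γ₀ k g → …`, histories `FlowStep.prefixOf g k`, (L)'s antecedent over the previous levels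
`k₁ < k` of the SAME run `g` with NO inner guard, `β` BOUND).  Strong induction on `k` for each fixed run; the guard is prefix-closed
(`RGEqH k β g → RGEqH k₁ β g` and `InInterval γ₀ k g → InInterval γ₀ k₁ g` for `k₁ ≤ k`, definitional one-liners), so the induction hypothesis at
`k₁ < k` applies to the same `g`.  Conclusion: format `E₀ := σ∕(1 − ρ)` along every guarded run — 27930⁸'s consequent shape.
[cite: Balaban1987RG1, (1.18)–(1.19) p.263, (0.20) p.256, Thm 3 p.264; Balaban1988RG2Cluster, p.21] -/
theorem formatPlusG_uniform_of_split_flow {β : FlowStep.HBeta} {γ₀ σ ρ Ē κ : ℝ} (hσ : 0 < σ) (hρ1 : ρ < 1)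
    (hcl : σ ≤ (1 - ρ) * Ē)
    (hZ : ∀ (k : ℕ) (g : ℕ → ℝ), FlowStep.RGEqH k β g → Step.InInterval γ₀ k g →
      FormatPlusG (S k) (M k) (act k) (Uc k) (coords k) (m k) (χ k) (Φz k (FlowStep.prefixOf g k)) (ι k) (wrap k) (emb k)
        (πc k) σ κ)
    (hL : ∀ (k : ℕ) (g : ℕ → ℝ), FlowStep.RGEqH k β g → Step.InInterval γ₀ k g → ∀ E : ℝ, 0 < E → E ≤ Ē →
      (∀ k₁, k₁ < k →
        FormatPlusG (S k₁) (M k₁) (act k₁) (Uc k₁) (coords k₁) (m k₁) (χ k₁) (Φ k₁ (FlowStep.prefixOf g k₁)) (ι k₁)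
          (wrap k₁) (emb k₁) (πc k₁) E κ) →
      FormatPlusG (S k) (M k) (act k) (Uc k) (coords k) (m k) (χ k)
        (fun n B => Φ k (FlowStep.prefixOf g k) n B - Φz k (FlowStep.prefixOf g k) n B) (ι k) (wrap k) (emb k) (πc k)
        (ρ * E) κ) :
    ∀ (k : ℕ) (g : ℕ → ℝ), FlowStep.RGEqH k β g → Step.InInterval γ₀ k g →
      FormatPlusG (S k) (M k) (act k) (Uc k) (coords k) (m k) (χ k) (Φ k (FlowStep.prefixOf g k)) (ι k) (wrap k) (emb k)
        (πc k) (σ / (1 - ρ)) κ := by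
  have hE0 := E₀_pos_of_split hσ hρ1
  have hEbar := E₀_le_of_split hρ1 hcl
  intro k
  induction k using Nat.strong_induction_on with
  | h k ih =>
    intro g hfl hin
    have hprev : ∀ k₁, k₁ < k →
        FormatPlusG (S k₁) (M k₁) (act k₁) (Uc k₁) (coords k₁) (m k₁) (χ k₁) (Φ k₁ (FlowStep.prefixOf g k₁)) (ι k₁)
          (wrap k₁) (emb k₁) (πc k₁) (σ / (1 - ρ)) κ :=
      fun k₁ hk₁ => ih k₁ hk₁ g (fun j hj => hfl j (lt_trans hj hk₁)) (fun j hj => hin j (hj.trans hk₁.le))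
    have h := formatPlusG_of_split (hZ k g hfl hin) (hL k g hfl hin (σ / (1 - ρ)) hE0 hEbar hprev)
    rwa [split_const_eq hρ1] at h

/-- **THE ALL-RUNS VARIANT** (typer v3 shape 194d36781ea0712a: (L)'s antecedent quantifies over EVERY guarded run `g₁` at each previous level `k₁ < k`
— a stronger antecedent, hence a weaker (L); the induction closes all the same because the conclusion is proved for all guarded runs at once).
[cite: Balaban1987RG1, (1.18)–(1.19) p.263; Balaban1988RG2Cluster, p.21] -/
theorem formatPlusG_uniform_of_split_flow_allRuns {β : FlowStep.HBeta} {γ₀ σ ρ Ē κ : ℝ} (hσ : 0 < σ) (hρ1 : ρ < 1)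
    (hcl : σ ≤ (1 - ρ) * Ē)
    (hZ : ∀ (k : ℕ) (g : ℕ → ℝ), FlowStep.RGEqH k β g → Step.InInterval γ₀ k g →
      FormatPlusG (S k) (M k) (act k) (Uc k) (coords k) (m k) (χ k) (Φz k (FlowStep.prefixOf g k)) (ι k) (wrap k) (emb k)
        (πc k) σ κ)
    (hL : ∀ (k : ℕ) (g : ℕ → ℝ), FlowStep.RGEqH k β g → Step.InInterval γ₀ k g → ∀ E : ℝ, 0 < E → E ≤ Ē →
      (∀ k₁, k₁ < k → ∀ g₁ : ℕ → ℝ, FlowStep.RGEqH k₁ β g₁ → Step.InInterval γ₀ k₁ g₁ →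
        FormatPlusG (S k₁) (M k₁) (act k₁) (Uc k₁) (coords k₁) (m k₁) (χ k₁) (Φ k₁ (FlowStep.prefixOf g₁ k₁)) (ι k₁)
          (wrap k₁) (emb k₁) (πc k₁) E κ) →
      FormatPlusG (S k) (M k) (act k) (Uc k) (coords k) (m k) (χ k)
        (fun n B => Φ k (FlowStep.prefixOf g k) n B - Φz k (FlowStep.prefixOf g k) n B) (ι k) (wrap k) (emb k) (πc k)
        (ρ * E) κ) :
    ∀ (k : ℕ) (g : ℕ → ℝ), FlowStep.RGEqH k β g → Step.InInterval γ₀ k g →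
      FormatPlusG (S k) (M k) (act k) (Uc k) (coords k) (m k) (χ k) (Φ k (FlowStep.prefixOf g k)) (ι k) (wrap k) (emb k)
        (πc k) (σ / (1 - ρ)) κ := by
  have hE0 := E₀_pos_of_split hσ hρ1
  have hEbar := E₀_le_of_split hρ1 hcl
  intro k
  induction k using Nat.strong_induction_on with
  | h k ih =>
    intro g hfl hin
    have h := formatPlusG_of_split (hZ k g hfl hin)
      (hL k g hfl hin (σ / (1 - ρ)) hE0 hEbar fun k₁ hk₁ g₁ hfl₁ hin₁ => ih k₁ hk₁ g₁ hfl₁ hin₁)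
    rwa [split_const_eq hρ1] at h

/-- **BOX ⟹ FLOW for the conclusion** (the box binder is the stronger statement: a guarded run's prefix lies in the box): if `Φ k v` has format `E₀`
for every `v ∈ Box γ₀ k`, then it has it along `prefixOf g k` of every run in the interval `]0, γ₀]` up to `k` (no flow equation needed) — the
direction `text30Jv8_of_text30J` of lens-2's probe at the mould level. [cite: Balaban1987RG1, Thm 3 p.264 (bookkeeping)] -/
theorem formatPlusG_flow_of_box {β : FlowStep.HBeta} {γ₀ E₀ κ : ℝ}
    (h : ∀ k v, v ∈ FlowStep.Box γ₀ k →
      FormatPlusG (S k) (M k) (act k) (Uc k) (coords k) (m k) (χ k) (Φ k v) (ι k) (wrap k) (emb k) (πc k) E₀ κ) :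
    ∀ (k : ℕ) (g : ℕ → ℝ), FlowStep.RGEqH k β g → Step.InInterval γ₀ k g →
      FormatPlusG (S k) (M k) (act k) (Uc k) (coords k) (m k) (χ k) (Φ k (FlowStep.prefixOf g k)) (ι k) (wrap k) (emb k)
        (πc k) E₀ κ :=
  fun k _ _ hin => h k _ (FlowStep.mem_box.2 fun i => hin i (Nat.le_of_lt_succ i.isLt))

end Levels

end Summit.QuantumFields.YangMills.Theorems.PortZDSplit

end
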